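import Summits.QuantumFields.YangMills.Theorems.BalabanUVNodesN26TransportGeneric
import Literature.MathematicalPhysics.QuantumFieldTheory.Balaban1983to89.Node00.ContinuousTransportOfRecord

/-!
# DAG node N26 — B4 «β-continuity» AT def-T's CONTINUOUS-VERSION β `Node00.betaOfRecord₈c ∕ betaOfRecord₉c` (`Node00/ContinuousTransportOfRecord.lean`,
# p423705): the (D4) socket and N26's literal at the β the successor record `Record10` is to carry as `βfun` — the `T := TcOfRecord` instance of
# `BalabanUVNodesN26TransportGeneric` §3, BY NAME (`rfl` bridges only)

Cell `pub-ymgap`, YM-PLAN Track A (HUMAN RULING D-0062), seat `pub-ymgap-dag-n26-a` (gen 4; -a = KNIT-BY-NAME); thirteenth N26 companion.  STATUS OF RECORD: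
N26 = binder B4 is DEPENDENT on (D4) and VACATED in the discharge form of record (closes WITH B3 = N25, NODE O); instance 0∕1.

WHAT IS HERE (compositions BY NAME; no definition, no estimate, 0 `sorry`):
* §1 `betaOfRecord₈T_eq_betaT` (def-T's transport-generic β IS the displayed `(T, chiFixed7 θ.ν)` body of `…N26TransportGeneric` §3, `rfl`),
  `betaContH_betaOfRecord₈T_iff`, `n26lit_betaOfRecord₈T_of_localizedRep` (any transport family `T`).
* §2 AT THE CONTINUOUS-VERSION TRANSPORT `TcOfRecord`: `betaContH_betaOfRecord₈c_iff` ∕ `betaContH_betaOfRecord₉c_iff` (what B4 IS there: per-`k`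
  history-continuity of the merged β over `(TcOfRecord, chiFixed7 θ.ν)` on the box), `n26lit_betaOfRecord₈c_of_localizedRep` ∕ `n26lit_betaOfRecord₉c_of_localizedRep`
  (N26's literal from the (D4) socket inputs for THAT merged family on a box `0 < γ₀ ≤ θ.γ`).
RIDER OF RECORD №6 ∕ dag-ref-D (C1)–(C3) (pub-ymgap INBOX l.11076, READ #76 l.11082): over `betaOfRecord₉c` BOTH hazards of the Stage-8∕9 reading are absent
(point values DETERMINED — `Node00.contVersion_eq_of_continuous`, `TcOfRecord_eq_of_continuous`; χ flow-blind — `Node00.chiFixed7_flowBlind`) PROVIDED the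
record's predicate CONJOINS the located proviso `Stage8Params.HasContTransportAlong θ` — or its on-domain ∕ on-box localisation, dag-ref-D READ #76 (L1)(L2) —
(off it `contVersion` is junk `0`); so a β-side binder over this β is bookable only at such a record (`Record10`), and nothing is booked HERE: θ is a parameter, the socket inputs are located hypotheses of NODE O (instance 0∕1),
N26 NOT discharged; nothing of Bałaban's β asserted.  One finite four-torus programme at fixed ε per run — NOT the continuum limit, NOT ℝ⁴, NOT infinite
volume, NOT OS, NOT a mass gap, NOT Clay.
Sources (context): [I] = [Balaban1987RG1]: (0.13) p. 254, (0.19) p. 255, (1.7) p. 261, (2.9) p. 259, (1.20)–(1.22) p. 264, (5.10) p. 293; [II] =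
[Balaban1988RG2Cluster]: Lemma 3 (2.38) p. 20.
-/

noncomputable section

open scoped Matrix.Norms.L2Operator

namespace Summit.QuantumFields.YangMills.Theorems.BalabanUVNodesN26AtBetaC

open Literature.MathematicalPhysics.QuantumFieldTheory.Balaban1983to89
open Literature.MathematicalPhysics.QuantumFieldTheory.Balaban1983to89.FlowStep
open Literature.MathematicalPhysics.QuantumFieldTheory.Balaban1983to89.T4Continuum (T4Family)
open Literature.MathematicalPhysics.QuantumFieldTheory.Balaban1983to89.Node00
open Literature.MathematicalPhysics.QuantumFieldTheory.Balaban1983to89.B13ScaleTransfer (Pt)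
open Literature.MathematicalPhysics.QuantumFieldTheory.Balaban1983to89.Beta.RemainderChainLattice
open Literature.MathematicalPhysics.QuantumFieldTheory.Balaban1983to89.Beta.RemainderLimitTorus (LDom limKernel)
open Literature.MathematicalPhysics.QuantumFieldTheory.Balaban1983to89.Beta.RemainderDecay190
open Literature.MathematicalPhysics.QuantumFieldTheory.Balaban1983to89.Beta.RemainderLocalityHolo (PolLeavesTFac190H)
open Summit.QuantumFields.YangMills.Theorems.BalabanUVNodesN26TransportGeneric
  (betaContH_betaT_iff n26lit_betaT_chiFixed_of_localizedRep)
open Filter Topology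

variable (F : T4Family) (N : ℕ) [NeZero N]

/-! ## §1 def-T's transport-generic β `betaOfRecord₈T T θ` -/

section Generic

variable (T : Transport F N)

/-- **def-T's `betaOfRecord₈T F N T θ` IS the displayed `(T, chiFixed7 θ.ν)` body** (`rfl`). [cite: Balaban1987RG1, (1.20)-(1.22) p.264 (bookkeeping)] -/
theorem betaOfRecord₈T_eq_betaT (θ : Stage8Params F N) :
    betaOfRecord₈T F N T θ =
      letI := θ.instVβ₁; letI := θ.instVβ₂; letI := θ.instιβ
      betaOfMerged (betaMerged F (mergedTermFamilyMatT F N T (chiFixed7 F N θ.ν) θ.εbg) θ.ρ8 θ.bV)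
        (beta0OfMerged (betaMerged F (mergedTermFamilyMatT F N T (chiFixed7 F N θ.ν) θ.εbg) θ.ρ8 θ.bV) θ.v₀) θ.γ := rfl

/-- **WHAT B4 IS at `betaOfRecord₈T T θ`**: on a box `γc ≤ θ.γ`, per-`k` history-continuity of the merged β over `(T, chiFixed7 θ.ν)`.
[cite: Balaban1987RG1, (1.20)-(1.22) p.264] -/
theorem betaContH_betaOfRecord₈T_iff (θ : Stage8Params F N) {γc : ℝ} (hle : γc ≤ θ.γ) :
    BetaContH γc (betaOfRecord₈T F N T θ) ↔
      letI := θ.instVβ₁; letI := θ.instVβ₂; letI := θ.instιβ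
      ∀ k, ContinuousOn (betaMerged F (mergedTermFamilyMatT F N T (chiFixed7 F N θ.ν) θ.εbg) θ.ρ8 θ.bV k) (Box γc k) :=
  betaContH_betaT_iff F N T (chiFixed7 F N θ.ν) θ hle

/-- **N26's LITERAL at `betaOfRecord₈T T θ`** from the (D4) socket inputs for the `(T, chiFixed7 θ.ν)` merged family on a box `0 < γ₀ ≤ θ.γ`
(`…N26TransportGeneric.n26lit_betaT_chiFixed_of_localizedRep` BY NAME).  Instance 0∕1 for Bałaban's objects; N26 NOT discharged.
[cite: Balaban1987RG1, (1.7) p.261, (1.20)-(1.22) p.264 and (5.10) p.293; Balaban1988RG2Cluster, Lemma 3 (2.38) p.20] -/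
theorem n26lit_betaOfRecord₈T_of_localizedRep (θ : Stage8Params F N) {γ₀ : ℝ} (hγ₀ : 0 < γ₀) (hle : γ₀ ≤ θ.γ) {M : ℕ} [NeZero M]
    {c : B13.Consts} {ℓ α₂ : ℝ} {q : Consts190} (P0 : ℕ → Pt 4 → ℝ)
    (hβ0 : letI := θ.instVβ₁; letI := θ.instVβ₂; letI := θ.instιβ
      ∀ k, beta0OfMerged (betaMerged F (mergedTermFamilyMatT F N T (chiFixed7 F N θ.ν) θ.εbg) θ.ρ8 θ.bV) θ.v₀ k =
        B12Beta.secondMoment (fun _ _ => P0 k) 0 1)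
    (hP0 : ∀ k, ∃ C δ₁ : ℝ, 0 < δ₁ ∧ B12Sec2to5.Decay510 (P0 k) C δ₁)
    (A1 : (k : ℕ) → (Fin (k + 1) → ℝ) → LDom 4 → Pt 4 → ℝ)
    (hrep : letI := θ.instVβ₁; letI := θ.instVβ₂; letI := θ.instιβ
      ∀ k (p : Fin (k + 1) → ℝ), p ∈ Box γ₀ k → ∀ z : Pt 4,
        polLimit F (k + 1) (fun K => mergedTermFamilyMatT F N T (chiFixed7 F N θ.ν) θ.εbg k p K) θ.ρ8 θ.bV 0 1 z =
          P0 k z + limKernel (A1 k p) z)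
    (hleaves : ∀ k (p : Fin (k + 1) → ℝ), p ∈ Box γ₀ k → PolLeavesTFac190H 4 M (A1 k p) c ℓ α₂ q)
    (hC : CondsL 4 c ℓ) (h22 : c.R22gen ℓ) (hq : q.Valid c.δ₀) (hs : SignsL c α₂ q.B₃)
    (hcont : letI := θ.instVβ₁; letI := θ.instVβ₂; letI := θ.instιβ
      ∀ k (z : Pt 4), ContinuousOn (fun p : Fin (k + 1) → ℝ =>
        polLimit F (k + 1) (fun K => mergedTermFamilyMatT F N T (chiFixed7 F N θ.ν) θ.εbg k p K) θ.ρ8 θ.bV 0 1 z) (Box γ₀ k)) :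
    ∃ γc : ℝ, 0 < γc ∧ BetaContH γc (betaOfRecord₈T F N T θ) :=
  n26lit_betaT_chiFixed_of_localizedRep F N T θ hγ₀ hle P0 hβ0 hP0 A1 hrep hleaves hC h22 hq hs hcont

end Generic

/-! ## §2 At the continuous-version transport of record `TcOfRecord`: `betaOfRecord₈c` ∕ `betaOfRecord₉c` -/

section Continuous

/-- **WHAT B4 IS at `betaOfRecord₈c θ`**: on a box `γc ≤ θ.γ`, per-`k` history-continuity of the merged β over `(TcOfRecord, chiFixed7 θ.ν)` — a β whose
point values are determined (`TcOfRecord_eq_of_continuous`) and whose χ is flow-blind; decidable for Bałaban's objects AT A RECORD CONJOINING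
`HasContTransportAlong θ` (dag-ref-D (C1)). [cite: Balaban1987RG1, (0.13) p.254 and (1.20)-(1.22) p.264] -/
theorem betaContH_betaOfRecord₈c_iff (θ : Stage8Params F N) {γc : ℝ} (hle : γc ≤ θ.γ) :
    BetaContH γc (betaOfRecord₈c F N θ) ↔
      letI := θ.instVβ₁; letI := θ.instVβ₂; letI := θ.instιβ
      ∀ k, ContinuousOn (betaMerged F (mergedTermFamilyMatT F N (TcOfRecord F N) (chiFixed7 F N θ.ν) θ.εbg) θ.ρ8 θ.bV k) (Box γc k) :=
  betaContH_betaOfRecord₈T_iff F N (TcOfRecord F N) θ hle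

/-- … and at Stage-9 parameters, `betaOfRecord₉c θ = betaOfRecord₈c θ.toStage8Params` (`Node00.betaOfRecord₉c_eq`).
[cite: Balaban1987RG1, (0.13) p.254 and (1.20)-(1.22) p.264] -/
theorem betaContH_betaOfRecord₉c_iff (θ : Stage9Params F N) {γc : ℝ} (hle : γc ≤ θ.γ) :
    BetaContH γc (betaOfRecord₉c F N θ) ↔
      letI := θ.instVβ₁; letI := θ.instVβ₂; letI := θ.instιβ
      ∀ k, ContinuousOn
        (betaMerged F (mergedTermFamilyMatT F N (TcOfRecord F N) (chiFixed7 F N θ.ν) θ.εbg) θ.ρ8 θ.bV k) (Box γc k) :=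
  betaContH_betaOfRecord₈c_iff F N θ.toStage8Params hle

/-- **N26's LITERAL at `betaOfRecord₈c θ`** — the β def-T's successor record is to carry — from the (D4) socket inputs for the `(TcOfRecord, chiFixed7 θ.ν)`
merged family on a box `0 < γ₀ ≤ θ.γ`: one-loop kernels `P0` pinned on `beta0OfMerged … θ.v₀` with (5.10), leaf kernels `A1` with [II]-(2.38)∕(190)
records, the localized representation `hrep` of the merged LIMIT kernel, the side conditions, (C-pt).  Every input a located hypothesis of NODE O about the
record's OWN objects — now VERSION-FREE statements (RIDER №6 (a)(b) absent at a record conjoining `HasContTransportAlong`); instance 0∕1; N26 NOT discharged.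
[cite: Balaban1987RG1, (0.13) p.254, (1.7) p.261, (2.9) p.259, (1.20)-(1.22) p.264 and (5.10) p.293; Balaban1988RG2Cluster, Lemma 3 (2.38) p.20] -/
theorem n26lit_betaOfRecord₈c_of_localizedRep (θ : Stage8Params F N) {γ₀ : ℝ} (hγ₀ : 0 < γ₀) (hle : γ₀ ≤ θ.γ) {M : ℕ} [NeZero M]
    {c : B13.Consts} {ℓ α₂ : ℝ} {q : Consts190} (P0 : ℕ → Pt 4 → ℝ)
    (hβ0 : letI := θ.instVβ₁; letI := θ.instVβ₂; letI := θ.instιβ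
      ∀ k, beta0OfMerged (betaMerged F (mergedTermFamilyMatT F N (TcOfRecord F N) (chiFixed7 F N θ.ν) θ.εbg) θ.ρ8 θ.bV) θ.v₀ k =
        B12Beta.secondMoment (fun _ _ => P0 k) 0 1)
    (hP0 : ∀ k, ∃ C δ₁ : ℝ, 0 < δ₁ ∧ B12Sec2to5.Decay510 (P0 k) C δ₁)
    (A1 : (k : ℕ) → (Fin (k + 1) → ℝ) → LDom 4 → Pt 4 → ℝ)
    (hrep : letI := θ.instVβ₁; letI := θ.instVβ₂; letI := θ.instιβ
      ∀ k (p : Fin (k + 1) → ℝ), p ∈ Box γ₀ k → ∀ z : Pt 4,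
        polLimit F (k + 1) (fun K => mergedTermFamilyMatT F N (TcOfRecord F N) (chiFixed7 F N θ.ν) θ.εbg k p K) θ.ρ8 θ.bV 0 1 z =
          P0 k z + limKernel (A1 k p) z)
    (hleaves : ∀ k (p : Fin (k + 1) → ℝ), p ∈ Box γ₀ k → PolLeavesTFac190H 4 M (A1 k p) c ℓ α₂ q)
    (hC : CondsL 4 c ℓ) (h22 : c.R22gen ℓ) (hq : q.Valid c.δ₀) (hs : SignsL c α₂ q.B₃)
    (hcont : letI := θ.instVβ₁; letI := θ.instVβ₂; letI := θ.instιβ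
      ∀ k (z : Pt 4), ContinuousOn (fun p : Fin (k + 1) → ℝ =>
        polLimit F (k + 1) (fun K => mergedTermFamilyMatT F N (TcOfRecord F N) (chiFixed7 F N θ.ν) θ.εbg k p K) θ.ρ8 θ.bV 0 1 z)
        (Box γ₀ k)) :
    ∃ γc : ℝ, 0 < γc ∧ BetaContH γc (betaOfRecord₈c F N θ) :=
  n26lit_betaOfRecord₈T_of_localizedRep F N (TcOfRecord F N) θ hγ₀ hle P0 hβ0 hP0 A1 hrep hleaves hC h22 hq hs hcont

/-- **N26's LITERAL at `betaOfRecord₉c θ`** (Stage-9 parameters; `= betaOfRecord₈c θ.toStage8Params`), same inputs.  This is the by-name statement of N26 at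
the β of the successor record `Record10` the moment it pins `βfun := betaOfRecord₉c` (then `n26_…_of_isRecordOfRecord₁₀C` is one `obtain` away, as at ₈∕₉).
[cite: Balaban1987RG1, (0.13) p.254, (1.7) p.261, (1.20)-(1.22) p.264 and (5.10) p.293; Balaban1988RG2Cluster, Lemma 3 (2.38) p.20] -/
theorem n26lit_betaOfRecord₉c_of_localizedRep (θ : Stage9Params F N) {γ₀ : ℝ} (hγ₀ : 0 < γ₀) (hle : γ₀ ≤ θ.γ) {M : ℕ} [NeZero M]
    {c : B13.Consts} {ℓ α₂ : ℝ} {q : Consts190} (P0 : ℕ → Pt 4 → ℝ)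
    (hβ0 : letI := θ.instVβ₁; letI := θ.instVβ₂; letI := θ.instιβ
      ∀ k, beta0OfMerged (betaMerged F (mergedTermFamilyMatT F N (TcOfRecord F N) (chiFixed7 F N θ.ν) θ.εbg) θ.ρ8 θ.bV) θ.v₀ k =
        B12Beta.secondMoment (fun _ _ => P0 k) 0 1)
    (hP0 : ∀ k, ∃ C δ₁ : ℝ, 0 < δ₁ ∧ B12Sec2to5.Decay510 (P0 k) C δ₁)
    (A1 : (k : ℕ) → (Fin (k + 1) → ℝ) → LDom 4 → Pt 4 → ℝ)
    (hrep : letI := θ.instVβ₁; letI := θ.instVβ₂; letI := θ.instιβ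
      ∀ k (p : Fin (k + 1) → ℝ), p ∈ Box γ₀ k → ∀ z : Pt 4,
        polLimit F (k + 1) (fun K => mergedTermFamilyMatT F N (TcOfRecord F N) (chiFixed7 F N θ.ν) θ.εbg k p K) θ.ρ8 θ.bV 0 1 z =
          P0 k z + limKernel (A1 k p) z)
    (hleaves : ∀ k (p : Fin (k + 1) → ℝ), p ∈ Box γ₀ k → PolLeavesTFac190H 4 M (A1 k p) c ℓ α₂ q)
    (hC : CondsL 4 c ℓ) (h22 : c.R22gen ℓ) (hq : q.Valid c.δ₀) (hs : SignsL c α₂ q.B₃)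
    (hcont : letI := θ.instVβ₁; letI := θ.instVβ₂; letI := θ.instιβ
      ∀ k (z : Pt 4), ContinuousOn (fun p : Fin (k + 1) → ℝ =>
        polLimit F (k + 1) (fun K => mergedTermFamilyMatT F N (TcOfRecord F N) (chiFixed7 F N θ.ν) θ.εbg k p K) θ.ρ8 θ.bV 0 1 z)
        (Box γ₀ k)) :
    ∃ γc : ℝ, 0 < γc ∧ BetaContH γc (betaOfRecord₉c F N θ) :=
  n26lit_betaOfRecord₈c_of_localizedRep F N θ.toStage8Params hγ₀ hle P0 hβ0 hP0 A1 hrep hleaves hC h22 hq hs hcont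

end Continuous

end Summit.QuantumFields.YangMills.Theorems.BalabanUVNodesN26AtBetaC

end
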